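import Summits.Ventures.CertifiedArithmetic.LowPrec.SRLimitedBitsMSE
import HarnessLib

/-!
# Stochastic rounding with limited randomness, CIII: a Bellman potential — the Pythagorean law for
every sign-consistent rule on every window, even against adaptive summands

HONEST FRAMING: certified error envelopes and provably optimal rounding/accumulation schemes for
low-precision formats under stated cost models; every table by two implementations; no hardware or
vendor claims.

Venture CertifiedArithmetic / lowprec, SR slice.  Files LX/XCII proved the mean-square-error law
`E(ŝₙ − (s + ∑ xₖ))² ≤ n·G²/4 + (n·ε·G)²` for recursive summation under a limited-randomness rule
`q : [0,1] → [0,1]`, `|q − id| ≤ ε`, on equally spaced one-signed windows (LX) and on DRIFT-ANTITONE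
outcome trees (XCII); XCIII–CI characterised when IEEE P3109 StochasticA (`A_N(η) = ⌊2^N η⌋/2^N`,
`ε = 2^{-N}`) is drift-antitone — on every unsaturated tree of a binary format iff `N ≥ emaxCode − 1`
(CI `valueSet_stochasticA_driftAntitone_iff`) — so with fewer bits the antitone route is closed, while no
violation of the LAW itself is known (sr-seat certificates gen16–gen18, evidence only).  This file and
CIV (`SRPythagorasOneBitFormats`) settle the extreme case of ONE random bit completely, by a different
mechanism that needs no window hypothesis and survives an ADAPTIVE choice of summands.

THE POTENTIAL.  `U_m(E) = (|E| + m·ε·G)² + m·G²/4` (accumulated error `E` after `m` additions).  One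
rounding step whose error `e ∈ {e₁, e₂}` (probabilities `π, 1 − π`) has mean `|ē| ≤ εG`, second moment
`≤ G²/4 + (εG)²` and MEAN ABSOLUTE value `π|e₁| + (1 − π)|e₂| ≤ εG` maps `E U_m` into `U_{m+1}`
(`potential_step`: `2E·ē ≤ 2|E|·εG` and `|E + e| ≤ |E| + |e|`, nothing else).  The third hypothesis is
the new one: for a rule `q` it reads `q(η)(1 − η) + (1 − q(η))η ≤ ε` on `[0,1]`, it implies
`|q − id| ≤ ε` (`abs_sub_le_of_meanAbs`), it forces `ε ≥ 1/2` (`half_le_of_meanAbs`, take `η = 1/2`),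
and for `ε = 1/2` it is EXACTLY sign-consistency `(q(η) − 1/2)(η − 1/2) ≥ 0`
(`meanAbs_le_half_of_sameSide`) — satisfied by StochasticA with `N ≥ 1` bits, StochasticB and
StochasticC with any `N` (CIV), and by exact SR.

* `accErrQ F q ξ n f s E = E[f(E + (ŝₙ − exact sum))]` — the outcome tree of recursive summation whose
  `k`-th summand `ξ k ŝₖ` may depend on the current partial sum (an ADAPTIVE adversary), carrying the
  accumulated error; `NoSatA`, `GapLEA` (decidable); `accExpQ_eq_accErrQ` (fixed summands are the
  special case `ξ k _ = x k`; `noSatA_const_iff`, `gapLEA_const_iff`).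
* `accErrQ_sq_le` — **MSE law for rules with mean absolute rounding error `≤ ε·gap`**: with no
  saturating branch and every candidate gap `≤ G`, `E (E₀ + ŝₙ − exact)² ≤ (|E₀| + n·ε·G)² + n·G²/4`
  on ANY finite value set of any linearly ordered field, any window, any sign pattern, ADAPTIVE
  summands; `accExpQ_sq_le_of_meanAbs` is the fixed-summand form `E(ŝₙ − (s + ∑ xₖ))² ≤ n·G²/4 +
  (n·ε·G)²` under `NoSat`/`GapLE` of file LVIII — the conclusion of XCII `accExpQ_sq_le_of_driftAntitone`
  WITHOUT drift-antitonicity, for this class of rules.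
* `accErrQ_sq_le_of_sameSide`, `accExpQ_sq_le_of_sameSide` — the `ε = 1/2` law
  `E(ŝₙ − sₙ)² ≤ n·G²/4 + (n·G/2)²` for every sign-consistent rule on every window.

CIV instantiates: StochasticA with ONE bit obeys its NOMINAL law (`ε = 2^{-1}`) on every window and on
the whole range of every binary format; StochasticB/C obey the `ε = 1/2` law; and an adaptive two-bit
adversary attains `6181/2048 > 3` inside one E3M2 binade, so no potential in (error, steps) proves the
two-bit law.  NOT claimed: the law for StochasticA with `2 ≤ N ≤ emaxCode − 2` bits and fixed summands
(OPEN; its nominal `ε = 2^{-N} < 1/2` is outside this file's hypothesis).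
Prior art: [ElararEtAl2025, Thm. 3–4] (`SR_{p,r}`, first order, relative model), [XiaEtAl2022],
IEEE P3109 (StochasticA/B/C); martingale / potential arguments for rounding-error accumulation are
classical in spirit ([ConnollyHighamMary2021] §4) but this discrete Bellman inequality for sign-consistent
limited-randomness rules, uniform over adaptive summands, has no precedent we found.  No Mathlib
precedent.
-/

namespace Summit.Ventures.CertifiedArithmetic.LowPrec.SR

open Literature.ComputerArithmetic.ConnollyHighamMary2021
open Finset

variable {K : Type*} [Field K] [LinearOrder K] [IsStrictOrderedRing K]

namespace LimitedBits

/-! ### Adaptive summands: the accumulated-error tree -/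

/-- `E[f(E + (ŝₙ − exact))]` for recursive summation from `ŝ₀ = s` with accumulated error `E`, whose
`k`-th summand `ξ k t` may depend on the current partial sum `t` (adaptive adversary); backward
recursion over the outcome tree, carrying the error. -/
def accErrQ (F : Finset K) (q : K → K) : (ℕ → K → K) → ℕ → (K → K) → K → K → K
  | _, 0, f, _, E => f E
  | ξ, n + 1, f, s, E =>
      pUpQ F q (s + ξ 0 s) * accErrQ F q (fun i => ξ (i + 1)) n f (up F (s + ξ 0 s))
          (E + (up F (s + ξ 0 s) - (s + ξ 0 s)))
        + (1 - pUpQ F q (s + ξ 0 s)) * accErrQ F q (fun i => ξ (i + 1)) n f (dn F (s + ξ 0 s))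
          (E + (dn F (s + ξ 0 s) - (s + ξ 0 s)))

/-- No pre-rounding value on any branch of the adaptive outcome tree leaves the hull. -/
def NoSatA (F : Finset K) : (ℕ → K → K) → ℕ → K → Prop
  | _, 0, _ => True
  | ξ, n + 1, s => InHull F (s + ξ 0 s) ∧ NoSatA F (fun i => ξ (i + 1)) n (up F (s + ξ 0 s))
      ∧ NoSatA F (fun i => ξ (i + 1)) n (dn F (s + ξ 0 s))

/-- Every candidate gap met on the adaptive outcome tree is `≤ G`. -/
def GapLEA (F : Finset K) (G : K) : (ℕ → K → K) → ℕ → K → Prop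
  | _, 0, _ => True
  | ξ, n + 1, s => up F (s + ξ 0 s) - dn F (s + ξ 0 s) ≤ G
      ∧ GapLEA F G (fun i => ξ (i + 1)) n (up F (s + ξ 0 s))
      ∧ GapLEA F G (fun i => ξ (i + 1)) n (dn F (s + ξ 0 s))

/-- Boolean evaluator of `NoSatA`. -/
def noSatAB (F : Finset K) : (ℕ → K → K) → ℕ → K → Bool
  | _, 0, _ => true
  | ξ, n + 1, s => decide (InHull F (s + ξ 0 s)) && noSatAB F (fun i => ξ (i + 1)) n (up F (s + ξ 0 s))
      && noSatAB F (fun i => ξ (i + 1)) n (dn F (s + ξ 0 s))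

omit [IsStrictOrderedRing K] in
/-- `noSatAB` computes `NoSatA`. -/
theorem noSatAB_iff (F : Finset K) (ξ : ℕ → K → K) (n : ℕ) (s : K) :
    noSatAB F ξ n s = true ↔ NoSatA F ξ n s := by
  induction n generalizing ξ s with
  | zero => simp [noSatAB, NoSatA]
  | succ n ih => simp [noSatAB, NoSatA, ih, Bool.and_eq_true, and_assoc]

/-- `NoSatA` is decidable. -/
instance instDecidableNoSatA (F : Finset K) (ξ : ℕ → K → K) (n : ℕ) (s : K) :
    Decidable (NoSatA F ξ n s) :=
  decidable_of_iff _ (noSatAB_iff F ξ n s)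

/-- Boolean evaluator of `GapLEA`. -/
def gapLEAB (F : Finset K) (G : K) : (ℕ → K → K) → ℕ → K → Bool
  | _, 0, _ => true
  | ξ, n + 1, s => decide (up F (s + ξ 0 s) - dn F (s + ξ 0 s) ≤ G)
      && gapLEAB F G (fun i => ξ (i + 1)) n (up F (s + ξ 0 s))
      && gapLEAB F G (fun i => ξ (i + 1)) n (dn F (s + ξ 0 s))

omit [IsStrictOrderedRing K] in
/-- `gapLEAB` computes `GapLEA`. -/
theorem gapLEAB_iff (F : Finset K) (G : K) (ξ : ℕ → K → K) (n : ℕ) (s : K) :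
    gapLEAB F G ξ n s = true ↔ GapLEA F G ξ n s := by
  induction n generalizing ξ s with
  | zero => simp [gapLEAB, GapLEA]
  | succ n ih => simp [gapLEAB, GapLEA, ih, Bool.and_eq_true, and_assoc]

/-- `GapLEA` is decidable. -/
instance instDecidableGapLEA (F : Finset K) (G : K) (ξ : ℕ → K → K) (n : ℕ) (s : K) :
    Decidable (GapLEA F G ξ n s) :=
  decidable_of_iff _ (gapLEAB_iff F G ξ n s)

omit [IsStrictOrderedRing K] in
/-- Fixed summands: `NoSatA` of the constant strategy is `NoSat`. -/
theorem noSatA_const_iff (F : Finset K) :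
    ∀ (x : ℕ → K) (n : ℕ) (s : K), NoSatA F (fun k _ => x k) n s ↔ NoSat F x n s := by
  intro x n
  induction n generalizing x with
  | zero => intro s; simp [NoSatA, NoSat]
  | succ n ih =>
    intro s
    show InHull F (s + x 0) ∧ NoSatA F (fun i _ => x (i + 1)) n (up F (s + x 0))
        ∧ NoSatA F (fun i _ => x (i + 1)) n (dn F (s + x 0)) ↔
      InHull F (s + x 0) ∧ NoSat F (fun i => x (i + 1)) n (up F (s + x 0))
        ∧ NoSat F (fun i => x (i + 1)) n (dn F (s + x 0))
    rw [ih (fun i => x (i + 1)) (up F (s + x 0)), ih (fun i => x (i + 1)) (dn F (s + x 0))]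

omit [IsStrictOrderedRing K] in
/-- Fixed summands: `GapLEA` of the constant strategy is `GapLE`. -/
theorem gapLEA_const_iff (F : Finset K) (G : K) :
    ∀ (x : ℕ → K) (n : ℕ) (s : K), GapLEA F G (fun k _ => x k) n s ↔ GapLE F G x n s := by
  intro x n
  induction n generalizing x with
  | zero => intro s; simp [GapLEA, GapLE]
  | succ n ih =>
    intro s
    show up F (s + x 0) - dn F (s + x 0) ≤ G ∧ GapLEA F G (fun i _ => x (i + 1)) n (up F (s + x 0))
        ∧ GapLEA F G (fun i _ => x (i + 1)) n (dn F (s + x 0)) ↔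
      roundUp F (clamp F (s + x 0)) - roundDown F (clamp F (s + x 0)) ≤ G
        ∧ GapLE F G (fun i => x (i + 1)) n (up F (s + x 0))
        ∧ GapLE F G (fun i => x (i + 1)) n (dn F (s + x 0))
    rw [ih (fun i => x (i + 1)) (up F (s + x 0)), ih (fun i => x (i + 1)) (dn F (s + x 0))]
    rfl

omit [IsStrictOrderedRing K] in
/-- Fixed summands: the accumulated-error tree of the constant strategy is the usual expectation of a
function of the error `ŝₙ − (s + ∑ xₖ)`, shifted by `E`. -/
theorem accExpQ_eq_accErrQ (F : Finset K) (q : K → K) (f : K → K) :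
    ∀ (x : ℕ → K) (n : ℕ) (s E : K),
      accExpQ F q x n (fun y => f (E + (y - (s + ∑ i ∈ range n, x i)))) s
        = accErrQ F q (fun k _ => x k) n f s E := by
  intro x n
  induction n generalizing x with
  | zero => intro s E; simp [accExpQ, accErrQ]
  | succ n ih =>
    intro s E
    have hsum : s + ∑ i ∈ range (n + 1), x i = (s + x 0) + ∑ i ∈ range n, x (i + 1) := by
      rw [Finset.sum_range_succ']; ring
    rw [hsum]
    show stepQ F q (s + x 0) (accExpQ F q (fun i => x (i + 1)) n
        (fun y => f (E + (y - ((s + x 0) + ∑ i ∈ range n, x (i + 1)))))) =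
      pUpQ F q (s + x 0) * accErrQ F q (fun i _ => x (i + 1)) n f (up F (s + x 0))
          (E + (up F (s + x 0) - (s + x 0)))
        + (1 - pUpQ F q (s + x 0)) * accErrQ F q (fun i _ => x (i + 1)) n f (dn F (s + x 0))
          (E + (dn F (s + x 0) - (s + x 0)))
    have key : ∀ t : K, accExpQ F q (fun i => x (i + 1)) n
        (fun y => f (E + (y - ((s + x 0) + ∑ i ∈ range n, x (i + 1))))) t
        = accErrQ F q (fun i _ => x (i + 1)) n f t (E + (t - (s + x 0))) := by
      intro t
      have hfun : (fun y => f (E + (y - ((s + x 0) + ∑ i ∈ range n, x (i + 1)))))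
          = fun y => f ((E + (t - (s + x 0))) + (y - (t + ∑ i ∈ range n, x (i + 1)))) := by
        funext y; congr 1; ring
      rw [hfun]
      exact ih (fun i => x (i + 1)) t (E + (t - (s + x 0)))
    unfold stepQ
    rw [key, key]

/-! ### The potential step -/

/-- **Bellman inequality of the potential `U_m(E) = (|E| + m·b)² + m·A`.**  One rounding step with
outcomes `e₁` (probability `π`) and `e₂`, mean error `|π e₁ + (1−π) e₂| ≤ b`, second moment
`π e₁² + (1−π) e₂² ≤ A + b²` and mean ABSOLUTE error `π|e₁| + (1−π)|e₂| ≤ b`, maps `U_m` (with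
`M = m·b`, any `M ≥ 0`) into `U_{m+1}`:  `E U_m(E + e) ≤ (|E| + M + b)² + (m+1)·A`.
Proof: `E(E + e)² = E² + 2E·ē + E e² ≤ E² + 2|E| b + A + b²` and `E|E + e| ≤ |E| + E|e| ≤ |E| + b`. -/
theorem potential_step {π e₁ e₂ E M b A m : K} (hπ0 : 0 ≤ π) (hπ1 : π ≤ 1) (hM : 0 ≤ M)
    (h1 : |π * e₁ + (1 - π) * e₂| ≤ b) (h2 : π * e₁ ^ 2 + (1 - π) * e₂ ^ 2 ≤ A + b ^ 2)
    (h3 : π * |e₁| + (1 - π) * |e₂| ≤ b) :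
    π * ((|E + e₁| + M) ^ 2 + m * A) + (1 - π) * ((|E + e₂| + M) ^ 2 + m * A)
      ≤ (|E| + (M + b)) ^ 2 + (m + 1) * A := by
  have hπ1' : 0 ≤ 1 - π := sub_nonneg.mpr hπ1
  have hE : 0 ≤ |E| := abs_nonneg E
  have hEe : E * (π * e₁ + (1 - π) * e₂) ≤ |E| * b :=
    calc E * (π * e₁ + (1 - π) * e₂) ≤ |E * (π * e₁ + (1 - π) * e₂)| := le_abs_self _
      _ = |E| * |π * e₁ + (1 - π) * e₂| := abs_mul _ _
      _ ≤ |E| * b := mul_le_mul_of_nonneg_left h1 hE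
  have hquad : π * |E + e₁| ^ 2 + (1 - π) * |E + e₂| ^ 2 ≤ |E| ^ 2 + 2 * (|E| * b) + (A + b ^ 2) := by
    simp only [sq_abs]
    nlinarith [hEe, h2]
  have hlin : π * |E + e₁| + (1 - π) * |E + e₂| ≤ |E| + b := by
    have a1 := mul_le_mul_of_nonneg_left (abs_add_le E e₁) hπ0
    have a2 := mul_le_mul_of_nonneg_left (abs_add_le E e₂) hπ1'
    linarith
  have h2M := mul_le_mul_of_nonneg_left hlin (by positivity : (0 : K) ≤ 2 * M)
  nlinarith [hquad, h2M]

/-- Mean absolute error `≤ ε` (in units of the gap) implies mean error `≤ ε`: `|q − η| ≤ q(1−η) + (1−q)η`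
for `q, η ∈ [0,1]`. -/
theorem abs_sub_le_of_meanAbs {a η ε : K} (ha0 : 0 ≤ a) (ha1 : a ≤ 1) (h0 : 0 ≤ η) (h1 : η ≤ 1)
    (h : a * (1 - η) + (1 - a) * η ≤ ε) : |a - η| ≤ ε := by
  have p1 := mul_nonneg h0 (sub_nonneg.mpr ha1)
  have p2 := mul_nonneg ha0 (sub_nonneg.mpr h1)
  rw [abs_le]; constructor <;> nlinarith [p1, p2, h]

/-- The mean-absolute-error hypothesis forces `ε ≥ 1/2` (take `η = 1/2`): the theorem below is about
the `ε = 1/2` class, it cannot yield the nominal `ε = 2^{-N}` of an `N`-bit rule for `N ≥ 2`. -/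
theorem half_le_of_meanAbs {q : K → K} {ε : K}
    (hq3 : ∀ η, 0 ≤ η → η ≤ 1 → q η * (1 - η) + (1 - q η) * η ≤ ε) : 1 / 2 ≤ ε := by
  have := hq3 (1 / 2) (by norm_num) (by norm_num)
  linarith

/-- **Mean absolute error of one step**: if `q(η)(1−η) + (1−q(η))η ≤ ε` on `[0,1]` then at an in-hull
point `π·(⌈c⌉ − c) + (1 − π)·(c − ⌊c⌋) ≤ ε·(⌈c⌉ − ⌊c⌋)` (`π = pUpQ`; both signs of the window: on the
negative side the hypothesis is used at `1 − θ`). -/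
theorem stepQ_meanAbs_le (F : Finset K) {q : K → K} {ε : K}
    (hq3 : ∀ η, 0 ≤ η → η ≤ 1 → q η * (1 - η) + (1 - q η) * η ≤ ε) {c : K} (hc : InHull F c) :
    pUpQ F q c * (up F c - c) + (1 - pUpQ F q c) * (c - dn F c) ≤ ε * (up F c - dn F c) := by
  have hθ0 := pUp_nonneg F c
  have hθ1 := pUp_le_one F c
  have hγ : 0 ≤ up F c - dn F c := sub_nonneg.mpr (dn_le_up F c)
  have hid : pUp F c * up F c + (1 - pUp F c) * dn F c = c := by
    have h := step_id F c
    simp only [step, clamp_eq_self hc] at h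
    linear_combination h
  have e1 : up F c - c = (1 - pUp F c) * (up F c - dn F c) := by linear_combination hid
  have e2 : c - dn F c = pUp F c * (up F c - dn F c) := by linear_combination (-1 : K) * hid
  unfold pUpQ
  split_ifs with hd
  · calc q (pUp F c) * (up F c - c) + (1 - q (pUp F c)) * (c - dn F c)
        = (q (pUp F c) * (1 - pUp F c) + (1 - q (pUp F c)) * pUp F c) * (up F c - dn F c) := by
          rw [e1, e2]; ring
      _ ≤ ε * (up F c - dn F c) := mul_le_mul_of_nonneg_right (hq3 _ hθ0 hθ1) hγ
  · calc (1 - q (1 - pUp F c)) * (up F c - c) + (1 - (1 - q (1 - pUp F c))) * (c - dn F c)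
        = (q (1 - pUp F c) * (1 - (1 - pUp F c)) + (1 - q (1 - pUp F c)) * (1 - pUp F c))
            * (up F c - dn F c) := by rw [e1, e2]; ring
      _ ≤ ε * (up F c - dn F c) :=
          mul_le_mul_of_nonneg_right (hq3 _ (by linarith) (by linarith)) hγ

/-! ### The law for rules with mean absolute error `≤ ε·gap` (adaptive summands) -/

set_option maxHeartbeats 800000 in
/-- **MSE law, mean-absolute-error class, adaptive summands.**  If `q : [0,1] → [0,1]` has mean
absolute rounding error `q(η)(1−η) + (1−q(η))η ≤ ε` on `[0,1]`, then for every adaptive summand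
strategy `ξ` whose outcome tree from `ŝ₀ = s` never saturates and meets only candidate gaps `≤ G`,
and every initial error `E`:  `E (E + ŝₙ − exact)² ≤ (|E| + n·ε·G)² + n·G²/4` — any finite value
set, any window, any sign pattern.  Induction on `n` with the potential of `potential_step`; the three
one-step inputs are `abs_stepQ_id_sub_le` (mean), `stepQ_sq_le` (second moment) and
`stepQ_meanAbs_le` (mean absolute error). -/
theorem accErrQ_sq_le (F : Finset K) {q : K → K} {ε G : K}
    (hq01 : ∀ η, 0 ≤ η → η ≤ 1 → 0 ≤ q η ∧ q η ≤ 1)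
    (hq3 : ∀ η, 0 ≤ η → η ≤ 1 → q η * (1 - η) + (1 - q η) * η ≤ ε) :
    ∀ (ξ : ℕ → K → K) (n : ℕ) (s E : K), NoSatA F ξ n s → GapLEA F G ξ n s →
      accErrQ F q ξ n (fun e => e ^ 2) s E ≤ (|E| + n * (ε * G)) ^ 2 + n * (G ^ 2 / 4) := by
  have hq : ∀ η, 0 ≤ η → η ≤ 1 → |q η - η| ≤ ε := fun η h0 h1 =>
    abs_sub_le_of_meanAbs (hq01 η h0 h1).1 (hq01 η h0 h1).2 h0 h1 (hq3 η h0 h1)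
  have hε : 0 ≤ ε := (abs_nonneg _).trans (hq 0 le_rfl zero_le_one)
  intro ξ n
  induction n generalizing ξ with
  | zero => intro s E _ _; simp [accErrQ, sq_abs]
  | succ n ih =>
    rintro s E ⟨hin, hnu, hnd⟩ ⟨hg0, hgu, hgd⟩
    show pUpQ F q (s + ξ 0 s) * accErrQ F q (fun i => ξ (i + 1)) n (fun e => e ^ 2)
          (up F (s + ξ 0 s)) (E + (up F (s + ξ 0 s) - (s + ξ 0 s)))
        + (1 - pUpQ F q (s + ξ 0 s)) * accErrQ F q (fun i => ξ (i + 1)) n (fun e => e ^ 2)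
          (dn F (s + ξ 0 s)) (E + (dn F (s + ξ 0 s) - (s + ξ 0 s))) ≤ _
    set c := s + ξ 0 s with hc
    set ξ' : ℕ → K → K := fun i => ξ (i + 1) with hξ'
    have hcl : clamp F c = c := clamp_eq_self hin
    have hγ : up F c - dn F c ≤ G := hg0
    have hγ0 : 0 ≤ up F c - dn F c := sub_nonneg.mpr (dn_le_up F c)
    have hG : 0 ≤ G := hγ0.trans hγ
    have huc : c ≤ up F c := by unfold up; rw [hcl]; exact le_roundUp F _
    have hdc : dn F c ≤ c := by unfold dn; rw [hcl]; exact roundDown_le F _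
    have hMu := ih ξ' (up F c) (E + (up F c - c)) hnu hgu
    have hMd := ih ξ' (dn F c) (E + (dn F c - c)) hnd hgd
    obtain ⟨hp0, hp1⟩ := pUpQ_mem F hq01 c
    have hβ : |stepQ F q c (fun t => t) - clamp F c| ≤ ε * G :=
      (abs_stepQ_id_sub_le F hq c).trans (mul_le_mul_of_nonneg_left hγ hε)
    rw [hcl] at hβ
    simp only [stepQ] at hβ
    have hE2 : stepQ F q c (fun z => (z - c) ^ 2) ≤ G ^ 2 * (1 / 4 + ε ^ 2) :=
      (stepQ_sq_le F hq hin).trans (mul_le_mul_of_nonneg_right (pow_le_pow_left₀ hγ0 hγ 2)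
        (by positivity))
    simp only [stepQ] at hE2
    have hE3 : pUpQ F q c * (up F c - c) + (1 - pUpQ F q c) * (c - dn F c) ≤ ε * G :=
      (stepQ_meanAbs_le F hq3 hin).trans (mul_le_mul_of_nonneg_left hγ hε)
    have hnεG : 0 ≤ (n : K) * (ε * G) := mul_nonneg (Nat.cast_nonneg n) (mul_nonneg hε hG)
    set π := pUpQ F q c
    set u := up F c
    set d := dn F c
    set Mu := accErrQ F q ξ' n (fun e => e ^ 2) u (E + (u - c))
    set Md := accErrQ F q ξ' n (fun e => e ^ 2) d (E + (d - c))
    clear_value π u d Mu Md c ξ'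
    have h1 : |π * (u - c) + (1 - π) * (d - c)| ≤ ε * G := by
      have : π * (u - c) + (1 - π) * (d - c) = π * u + (1 - π) * d - c := by ring
      rw [this]; exact hβ
    have h2 : π * (u - c) ^ 2 + (1 - π) * (d - c) ^ 2 ≤ G ^ 2 / 4 + (ε * G) ^ 2 := by
      have : G ^ 2 * (1 / 4 + ε ^ 2) = G ^ 2 / 4 + (ε * G) ^ 2 := by ring
      linarith [hE2]
    have h3 : π * |u - c| + (1 - π) * |d - c| ≤ ε * G := by
      rw [abs_of_nonneg (sub_nonneg.mpr huc), abs_of_nonpos (sub_nonpos.mpr hdc), neg_sub]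
      exact hE3
    have hstep := potential_step (E := E) (m := (n : K)) (A := G ^ 2 / 4) hp0 hp1 hnεG h1 h2 h3
    have a1 := mul_le_mul_of_nonneg_left hMu hp0
    have a2 := mul_le_mul_of_nonneg_left hMd (sub_nonneg.mpr hp1)
    have hfin : (|E| + ((n : K) * (ε * G) + ε * G)) ^ 2 + ((n : K) + 1) * (G ^ 2 / 4)
        = (|E| + (↑(n + 1) : K) * (ε * G)) ^ 2 + (↑(n + 1) : K) * (G ^ 2 / 4) := by
      push_cast; ring
    linarith [hstep, a1, a2, hfin]

/-- **Fixed summands**: under the same hypotheses `E(ŝₙ − (s + ∑ xₖ))² ≤ n·G²/4 + (n·ε·G)²` with no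
drift-antitone or uniform-window hypothesis (compare XCII `accExpQ_sq_le_of_driftAntitone`). -/
theorem accExpQ_sq_le_of_meanAbs (F : Finset K) {q : K → K} {ε G : K}
    (hq01 : ∀ η, 0 ≤ η → η ≤ 1 → 0 ≤ q η ∧ q η ≤ 1)
    (hq3 : ∀ η, 0 ≤ η → η ≤ 1 → q η * (1 - η) + (1 - q η) * η ≤ ε) :
    ∀ (x : ℕ → K) (n : ℕ) (s : K), NoSat F x n s → GapLE F G x n s →
      accExpQ F q x n (fun t => (t - (s + ∑ i ∈ range n, x i)) ^ 2) s
        ≤ n * (G ^ 2 / 4) + (n * (ε * G)) ^ 2 := by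
  intro x n s hns hg
  have h := accErrQ_sq_le F hq01 hq3 (fun k _ => x k) n s 0 ((noSatA_const_iff F x n s).mpr hns)
    ((gapLEA_const_iff F G x n s).mpr hg)
  rw [← accExpQ_eq_accErrQ F q (fun e => e ^ 2) x n s 0] at h
  simp only [abs_zero, zero_add] at h
  linarith

/-! ### Sign-consistent rules: `ε = 1/2` -/

/-- A rule is SIGN-CONSISTENT when it rounds up with probability `≥ 1/2` exactly when exact SR does:
`(q(η) − 1/2)(η − 1/2) ≥ 0`.  Then (indeed iff) its mean absolute error is `≤ gap/2`:
`q(1−η) + (1−q)η = 1/2 − 2(q − 1/2)(η − 1/2)`. -/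
theorem meanAbs_le_half_of_sameSide {q : K → K}
    (hss : ∀ η, 0 ≤ η → η ≤ 1 → 0 ≤ (q η - 1 / 2) * (η - 1 / 2)) :
    ∀ η, 0 ≤ η → η ≤ 1 → q η * (1 - η) + (1 - q η) * η ≤ 1 / 2 := by
  intro η h0 h1
  have := hss η h0 h1
  have e : q η * (1 - η) + (1 - q η) * η = 1 / 2 - 2 * ((q η - 1 / 2) * (η - 1 / 2)) := by ring
  rw [e]; linarith

/-- **MSE law for sign-consistent rules, adaptive summands**:
`E (E + ŝₙ − exact)² ≤ (|E| + n·G/2)² + n·G²/4`. -/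
theorem accErrQ_sq_le_of_sameSide (F : Finset K) {q : K → K} {G : K}
    (hq01 : ∀ η, 0 ≤ η → η ≤ 1 → 0 ≤ q η ∧ q η ≤ 1)
    (hss : ∀ η, 0 ≤ η → η ≤ 1 → 0 ≤ (q η - 1 / 2) * (η - 1 / 2)) :
    ∀ (ξ : ℕ → K → K) (n : ℕ) (s E : K), NoSatA F ξ n s → GapLEA F G ξ n s →
      accErrQ F q ξ n (fun e => e ^ 2) s E ≤ (|E| + n * (1 / 2 * G)) ^ 2 + n * (G ^ 2 / 4) :=
  accErrQ_sq_le F hq01 (meanAbs_le_half_of_sameSide hss)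

/-- **MSE law for sign-consistent rules, fixed summands**: `E(ŝₙ − sₙ)² ≤ n·G²/4 + (n·G/2)²`. -/
theorem accExpQ_sq_le_of_sameSide (F : Finset K) {q : K → K} {G : K}
    (hq01 : ∀ η, 0 ≤ η → η ≤ 1 → 0 ≤ q η ∧ q η ≤ 1)
    (hss : ∀ η, 0 ≤ η → η ≤ 1 → 0 ≤ (q η - 1 / 2) * (η - 1 / 2)) :
    ∀ (x : ℕ → K) (n : ℕ) (s : K), NoSat F x n s → GapLE F G x n s →
      accExpQ F q x n (fun t => (t - (s + ∑ i ∈ range n, x i)) ^ 2) s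
        ≤ n * (G ^ 2 / 4) + (n * (1 / 2 * G)) ^ 2 :=
  accExpQ_sq_le_of_meanAbs F hq01 (meanAbs_le_half_of_sameSide hss)


end LimitedBits

end Summit.Ventures.CertifiedArithmetic.LowPrec.SR
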